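import Summits.QuantumFields.YangMills.Theorems.GrossTransferStubLinTestEnergyMassRows
import HarnessLib

/-!
# `GrossTransferStubLinTestMassRow` — KNIT-E2 SPLIT ROW (R6): THE MASS ROW OF `main_estimate` WITH THE PEN's CONSTANT
# (LINE 28 «GrossTransfer», `stub_linTest`; crux `UnitScaleTilt.HistoryTailL` stmt-QuantumFields-19936 ∕ `MeanDeviationL` stmt-QuantumFields-23083)

Cell `ym3-torus` (YM ladder rung R3 = continuum SU(2) Yang–Mills on the three-torus — a RUNG, NOT the Clay problem: not d = 4, not infinite volume,
not a mass gap); width seat `ym-ust-19936-w2` (gen 16), on the pen of `main_estimate`'s ask (px13 g12 2026-08-30T01:37:15Z «w2 g16: (R6) `mass_row_le`»);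
helper `--supports stmt-QuantumFields-23083`.  THEOREMS ONLY (0 `def`, 0 `sorry`, default heartbeats); Frobenius scope as ✓`mass_row`.

* `card_box_le` — `#Q_{3R}(z₀) ≤ (42L+85)³·L^{12j}` from the diameter row `6R + 1 ≤ (42L+85)·L^{4j}` (✓(W) `diam_le`).
* `mass_arith` — the real arithmetic `2·(A³L^{12j})·(3·(½(K₀+C₁)·M)²) ≤ 122·A³·(K₀+C₁)²·L^{16j}` for `M ≤ 9(L²)^j`.
* ★★★ `mass_row_le` — ✓w5 g17 `GrossTransferStubLinTestEnergyMassRows.mass_row` (the (R6) row up to the constant: `Σ_b ‖(u0 b)•(iσ_α)‖_F² ≤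
  2·#Q_{3R}·(3·(½(K₀+C₁)·M₀)²)`) + the two rows above: `∀ α, Σ_b ‖(u0 b)•(iσ_α)‖_F² ≤ 122·(42L+85)³·(K₀+C₁)²·L^{16j}`, `K₀ = Σ_e|G(e_e) − G(0)|` —
  the (R6) bullet of `main_estimate` by ONE `exact` (binders of ✓`mass_row` + `hM` + `hRle`).

HONEST SCOPE.  Arithmetic over a landed row; NOTHING of `main_estimate`, `stub_linTest`, 23083∕23133∕23134, `HistoryTailL` (19936), the rung R3, d = 4,
a continuum limit or a mass gap is proved here; the Yang–Mills mass gap is NOT proved.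
References: L. Gross, CMP 92 (1983) 137–162, Thm 2.2 [GrossCMP1983] (the transfer this row serves); G. Lawler (1991), Thm 1.5.5 [Lawler1991] (the
free Green kernel's decay behind ✓`mass_row`); T. Bałaban, CMP 102 (1985) 255–275, (1)–(3) p. 256 [Balaban1985UV3] (lattice sizes).
-/

noncomputable section

set_option autoImplicit false

open scoped BigOperators Matrix Matrix.Norms.Frobenius
open Complex Finset
open Literature.Probability.LatticeModels (latticeGreen)
open Literature.MathematicalPhysics.QuantumFieldTheory.Balaban1983to89
open Literature.MathematicalPhysics.QuantumFieldTheory.Balaban1983to89.T3ContinuumYM3Torus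
open Literature.MathematicalPhysics.QuantumFieldTheory.Balaban1983to89.B4Eq19LatticeOperators (Zd unitVec box mem_box card_box)
open Literature.MathematicalPhysics.QuantumFieldTheory.Balaban1983to89.T4AxialGaugeSmallField (castSite)
open Literature.MathematicalPhysics.QuantumFieldTheory.Balaban1983to89.B7Prop1Explicit (e)
open Literature.MathematicalPhysics.QuantumFieldTheory.Balaban1983to89.B10Eq18SigmaSU2 (pauli)
open Summit.QuantumFields.YangMills.Theorems.GrossTransferStubLinTestEnergyMassRows (mass_row)

namespace Summit.QuantumFields.YangMills.Theorems.GrossTransferStubLinTestMassRow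

/-- `#Q_{3R}(z₀) = (6R+1)³ ≤ (42L+85)³·L^{12j}` from `6R + 1 ≤ (42L+85)·L^{4j}` (`d = 3`). [cite: Balaban1985UV3, (1)-(3) p.256] -/
theorem card_box_le (F : T3Family) (K : ℕ) (z₀ : Zd (F.P K).d) (R : ℕ) {j : ℕ} (hRle : 6 * R + 1 ≤ (42 * F.L + 85) * F.L ^ (4 * j)) :
    (((box z₀ (3 * (R : ℤ))).card : ℕ) : ℝ) ≤ (42 * (F.L : ℝ) + 85) ^ 3 * (F.L : ℝ) ^ (12 * j) := by
  have hd : (F.P K).d = 3 := rfl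
  rw [card_box z₀ (by positivity), hd]
  have hcastR : ((2 * (3 * (R : ℤ)) + 1 : ℤ) : ℝ) ≤ (42 * (F.L : ℝ) + 85) * (F.L : ℝ) ^ (4 * j) := by
    have : (2 * (3 * (R : ℤ)) + 1 : ℤ) = ((6 * R + 1 : ℕ) : ℤ) := by push_cast; ring
    rw [this]; exact_mod_cast hRle
  have h0 : (0 : ℝ) ≤ ((2 * (3 * (R : ℤ)) + 1 : ℤ) : ℝ) := by positivity
  calc (((2 * (3 * (R : ℤ)) + 1 : ℤ) : ℝ)) ^ 3 ≤ ((42 * (F.L : ℝ) + 85) * (F.L : ℝ) ^ (4 * j)) ^ 3 := pow_le_pow_left₀ h0 hcastR 3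
    _ = (42 * (F.L : ℝ) + 85) ^ 3 * (F.L : ℝ) ^ (12 * j) := by rw [mul_pow, ← pow_mul]; ring_nf

/-- The (R6) arithmetic: for `0 ≤ A`, `0 ≤ K`, `0 ≤ M ≤ 9(L²)^j`, `card ≤ A³L^{12j}`:
`2·(card·(3·(½·K·M)²)) ≤ 122·A³·K²·L^{16j}`. [folklore] -/
theorem mass_arith {A Kc M card L : ℝ} {j : ℕ} (hA : 0 ≤ A) (hK : 0 ≤ Kc) (hM0 : 0 ≤ M) (hM : M ≤ 9 * (L ^ 2) ^ j) (hL : 0 ≤ L)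
    (hcard : card ≤ A ^ 3 * L ^ (12 * j)) :
    2 * (card * (3 * (1 / 2 * Kc * M) ^ 2)) ≤ 122 * A ^ 3 * Kc ^ 2 * L ^ (16 * j) := by
  have hKM0 : 0 ≤ 1 / 2 * Kc * M := by positivity
  have hKM : 1 / 2 * Kc * M ≤ 1 / 2 * Kc * (9 * (L ^ 2) ^ j) := mul_le_mul_of_nonneg_left hM (by positivity)
  have hsq : 3 * (1 / 2 * Kc * M) ^ 2 ≤ 3 * (1 / 2 * Kc * (9 * (L ^ 2) ^ j)) ^ 2 :=
    mul_le_mul_of_nonneg_left (pow_le_pow_left₀ hKM0 hKM 2) (by norm_num)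
  have hcard0' : (0 : ℝ) ≤ A ^ 3 * L ^ (12 * j) := by positivity
  have hprod := mul_le_mul hcard hsq (mul_nonneg (by norm_num) (sq_nonneg _)) hcard0'
  have e16 : L ^ (12 * j) * ((L ^ 2) ^ j) ^ 2 = L ^ (16 * j) := by
    rw [← pow_mul, ← pow_mul, ← pow_add]; congr 1; ring
  have hX0 : 0 ≤ A ^ 3 * Kc ^ 2 * L ^ (16 * j) := by positivity
  calc 2 * (card * (3 * (1 / 2 * Kc * M) ^ 2)) ≤ 2 * (A ^ 3 * L ^ (12 * j) * (3 * (1 / 2 * Kc * (9 * (L ^ 2) ^ j)) ^ 2)) :=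
        mul_le_mul_of_nonneg_left hprod (by norm_num)
    _ = (243 / 2) * (A ^ 3 * Kc ^ 2 * (L ^ (12 * j) * ((L ^ 2) ^ j) ^ 2)) := by ring
    _ = (243 / 2) * (A ^ 3 * Kc ^ 2 * L ^ (16 * j)) := by rw [e16]
    _ ≤ 122 * (A ^ 3 * Kc ^ 2 * L ^ (16 * j)) := mul_le_mul_of_nonneg_right (by norm_num) hX0
    _ = 122 * A ^ 3 * Kc ^ 2 * L ^ (16 * j) := by ring

/-- ★★★ **(R6) THE MASS ROW OF `main_estimate` WITH THE PEN's CONSTANT** (✓`mass_row` + `card_box_le` + `mass_arith`): in ✓`mass_row`'s binders plus the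
weight-mass bound `Σ_μΣ_νΣ_{Q_{ℓ0}(z₀)}|wt| ≤ 9(L²)^j` (✓M0-ROWS) and the diameter row `6R + 1 ≤ (42L+85)·L^{4j}` (✓(W) `diam_le`):
`∀ α, Σ_b ‖(u0 b)•(iσ_α)‖_F² ≤ 122·(42L+85)³·(K₀+C₁)²·L^{16j}`, `K₀ = Σ_e|G(e_e) − G(0)|`. [cite: GrossCMP1983, Thm 2.2] [cite: Lawler1991, Thm 1.5.5] -/
theorem mass_row_le (F : T3Family) (K : ℕ) {lo hi : Fin (F.P K).d → ℤ} (hN : ∀ κ, hi κ - lo κ < (F.P K).sitesPerDir 0)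
    {C₁ : ℝ} (hC₁ : 0 ≤ C₁)
    (hK1 : ∀ (e : Fin 3) (w : Zd 3) (n : ℕ), 1 ≤ n → w ∉ box (0 : Zd 3) ((n : ℤ) - 1) →
      |latticeGreen (w + unitVec e) - latticeGreen w| ≤ C₁ / (n : ℝ) ^ 2)
    {j : ℕ}
    (wt βt : Zd (F.P K).d → Fin (F.P K).d → Fin (F.P K).d → ℝ) (at' : Zd (F.P K).d → Fin (F.P K).d → ℝ)
    (z₀ : Zd (F.P K).d) (ℓ0 : ℕ)
    (hβt : ∀ x μ ν, βt x μ ν = ∑ y ∈ box z₀ (ℓ0 : ℤ), latticeGreen (x - y) / 2 * wt y μ ν)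
    (hat : ∀ x ν, at' x ν = ∑ μ, (βt (x - unitVec μ) μ ν - βt x μ ν))
    (hM : ∑ μ, ∑ ν', ∑ y ∈ box z₀ (ℓ0 : ℤ), |wt y μ ν'| ≤ 9 * (((F.L : ℝ)) ^ 2) ^ j)
    (χ : Zd (F.P K).d → ℝ) (aR : Zd (F.P K).d → Fin (F.P K).d → ℝ) (R : ℕ)
    (hχ01 : ∀ x, 0 ≤ χ x ∧ χ x ≤ 1) (hχ0 : ∀ x, x ∉ box z₀ (3 * (R : ℤ)) → χ x = 0)
    (haR : ∀ x ν, aR x ν = χ x * at' x ν)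
    (haR1 : ∀ x μ, aR x μ ≠ 0 → lo + 1 ≤ x ∧ x + unitVec μ + 1 ≤ hi)
    (hRle : 6 * R + 1 ≤ (42 * F.L + 85) * F.L ^ (4 * j))
    (u0 : PBond (F.P K) 0 → ℝ)
    (hu0 : ∀ (x : Fin (F.P K).d → ℤ) (μ : Fin (F.P K).d), lo ≤ x → x + e μ ≤ hi → u0 ⟨castSite x, μ⟩ = aR x μ)
    (hu0off : ∀ b : PBond (F.P K) 0, (¬ ∃ y : Fin (F.P K).d → ℤ, lo ≤ y ∧ y + e b.dir ≤ hi ∧ b.src = castSite y) → u0 b = 0) :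
    ∀ α : Fin 3, ∑ b : PBond (F.P K) 0, ‖((u0 b : ℝ) : ℂ) • (I • pauli α)‖ ^ 2 ≤
      122 * (42 * (F.L : ℝ) + 85) ^ 3 * ((∑ e' : Fin 3, |latticeGreen (unitVec e') - latticeGreen (0 : Zd 3)|) + C₁) ^ 2 * (F.L : ℝ) ^ (16 * j) := by
  intro α
  have h := mass_row F K hN hC₁ hK1 wt βt at' z₀ ℓ0 hβt hat χ aR R hχ01 hχ0 haR haR1 u0 hu0 hu0off α
  refine h.trans ?_
  have hK₀0 : 0 ≤ (∑ e' : Fin 3, |latticeGreen (unitVec e') - latticeGreen (0 : Zd 3)|) + C₁ :=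
    add_nonneg (Finset.sum_nonneg fun _ _ => abs_nonneg _) hC₁
  have hM0 : 0 ≤ ∑ μ, ∑ ν', ∑ y ∈ box z₀ (ℓ0 : ℤ), |wt y μ ν'| :=
    Finset.sum_nonneg fun _ _ => Finset.sum_nonneg fun _ _ => Finset.sum_nonneg fun _ _ => abs_nonneg _
  have hA : (0 : ℝ) ≤ 42 * (F.L : ℝ) + 85 := by positivity
  exact mass_arith hA hK₀0 hM0 hM (Nat.cast_nonneg _) (card_box_le F K z₀ R hRle)

end Summit.QuantumFields.YangMills.Theorems.GrossTransferStubLinTestMassRow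

end
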